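import Mathlib.Data.Fintype.Card
import Mathlib.Data.Finset.Card
import Mathlib.Data.Finset.Powerset
import Mathlib.Algebra.BigOperators.Group.Finset.Basic
import Mathlib.Algebra.Order.BigOperators.Group.Finset
import Mathlib.Combinatorics.Enumerative.DoubleCounting
import Mathlib.Tactic
import HarnessLib

/-!
# Venture HSemireg — flat (d, 2d+1) three-coordinate systems: shadows, mates, the twin dichotomy

Cell `pub-hsemireg`, widening group W5, seat w5-n7-1 (gen 14); note of record
`widen/W5/NO-FLAT-3-7-w5n7g13.md` §1 steps (1)–(3), (5) and §4 (THEOREM (T-all), hand proof by gen 13). This file is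
part 1 of the general-`d` companion of the tree leg `NoFlatThreeSeven` (`d = 3`); part 2, `NoFlatTwoDPlusOne`,
adds the twin-free branch and the theorem «no flat `(d, 2d+1)` triangle-free three-coordinate system for `d ≥ 3`».

SETTING (the lineage's abstract encoding, as in `FlatPentagonTwinFree` and `NoFlatThreeSeven`): three coordinates
with level types `α, β, γ` of `2d+1` elements each; the three torus graphs are given by neighbourhood maps with
transposes (`nAB/nBA`, `nAC/nCA`, `nBC/nCB`), every level has exactly `d` neighbours in each other coordinate
(a flat `(d, 2d+1)` system); TRIANGLE-FREE means `b ∈ nAB a → c ∈ nBC b → c ∉ nAC a`.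

CONTENT (finite counting):
* `le_inter_card_succ` — SHADOWS: if `a, a'` have a common `C`-neighbour `c` then `nAB a, nAB a' ⊆ (nCB c)ᶜ`, a set
  of `d+1` levels, so the two `d`-sets meet in `≥ d-1` levels.
* `sum_inter_card` — CODEGREE SUM: `∑_{a' ≠ a} #(nAB a ∩ nAB a') = d(d-1)` (double count).
* `inter_card_eq_zero_or`, `inter_card_eq_zero_of` — MATES (`d ≥ 2`): a common `B`-neighbour forces a common
  `C`-neighbour and conversely, so every codegree `#(nAB a ∩ nAB a')` is `0` or `≥ d-1`.
* `card_mates_of_twin_free` ∕ `twins_of_twin` — DICHOTOMY at a level `a` with mate set `M` (the `a' ≠ a` of non-zero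
  codegree): either `a` has no twin, `#M = d` and every mate has codegree exactly `d-1`; or `a` has a twin,
  `#M = d-1` and every mate is a twin (`nAB a' = nAB a`), and then also a twin in `C` (`nAC a' = nAC a`).
* `false_of_twins` — TWIN BRANCH (`d ≥ 2`): twins are impossible in a triangle-free system. With `T = {a} ∪ M`
  (`d` levels, `nAB = X`, `nAC = Z` on `T`) a `B`-level outside `X` and a `C`-level outside `Z` have their `d`
  `A`-neighbours inside the `(d+1)`-set `Tᶜ`, hence share one, hence are not adjacent; so every `B`-level outside `X`
  has `C`-neighbourhood `Z`, and a level of `Z` gets `≥ d+1 > d` `B`-neighbours.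

All cardinality hypotheses are stated additively (no truncated subtraction in a hypothesis); the one `d - 1` is in
the conclusion of `sum_inter_card`, exact for every `d`.

HONEST FRAMING: finite combinatorics on `(2d+1) + (2d+1) + (2d+1)` levels (necessary first-order conditions of the
flat cells of the widening tables). Nothing in this file is a statement about a variety, a sheaf or a Hodge class,
and nothing here bears on HC / HC_CM / HC_AV.
-/

namespace Summit.Ventures.HSemireg.NoFlatTwoDPlusOneDichotomy

open Finset

variable {α β γ : Type*} [Fintype α] [Fintype β] [Fintype γ] [DecidableEq α] [DecidableEq β] [DecidableEq γ]

omit [Fintype α] [Fintype γ] [DecidableEq α] [DecidableEq γ] in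
/-- **Shadows.** If two levels `a, a'` of `A` have a common `C`-neighbour `c`, their `B`-neighbourhoods both avoid
`nCB c` (a common level would close a triangle), i.e. they are `d`-subsets of a `(d+1)`-set, so they meet in at
least `d - 1` levels (stated additively). -/
theorem le_inter_card_succ (d : ℕ) (hβ : Fintype.card β = 2 * d + 1) (nAB : α → Finset β)
    (nAC : α → Finset γ) (nBC : β → Finset γ) (nCB : γ → Finset β) (cBC : ∀ b c, c ∈ nBC b ↔ b ∈ nCB c)
    (rAB : ∀ a, (nAB a).card = d) (rCB : ∀ c, (nCB c).card = d)
    (tABC : ∀ a b c, b ∈ nAB a → c ∈ nBC b → c ∉ nAC a) {a a' : α} {c : γ} (hc : c ∈ nAC a)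
    (hc' : c ∈ nAC a') : d ≤ (nAB a ∩ nAB a').card + 1 := by
  have hsub : nAB a ∪ nAB a' ⊆ (nCB c)ᶜ := by
    intro b hb
    rw [mem_compl]
    intro hbc
    rw [mem_union] at hb
    rcases hb with hb | hb
    · exact tABC a b c hb ((cBC b c).2 hbc) hc
    · exact tABC a' b c hb ((cBC b c).2 hbc) hc'
  have h1 := card_le_card hsub
  rw [card_compl, rCB, hβ] at h1
  have h2 := card_union_add_card_inter (nAB a) (nAB a')
  rw [rAB, rAB] at h2
  omega

omit [Fintype β] in
/-- **Codegree sum.** For a fixed level `a` of `A`: `∑_{a' ≠ a} #(nAB a ∩ nAB a') = d (d - 1)` — double count the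
pairs `(a', b)` with `a' ≠ a` and `b` a common `B`-neighbour of `a` and `a'`: each of the `d` levels `b ∈ nAB a`
has exactly `d - 1` further `A`-neighbours. -/
theorem sum_inter_card (d : ℕ) (nAB : α → Finset β) (nBA : β → Finset α)
    (cAB : ∀ a b, b ∈ nAB a ↔ a ∈ nBA b) (rAB : ∀ a, (nAB a).card = d) (rBA : ∀ b, (nBA b).card = d)
    (a : α) : ∑ a' ∈ univ.erase a, (nAB a ∩ nAB a').card = d * (d - 1) := by
  have hdc := Finset.sum_card_bipartiteAbove_eq_sum_card_bipartiteBelow (s := univ.erase a) (t := nAB a)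
    (r := fun a' b => b ∈ nAB a')
  have hL : ∀ a' ∈ univ.erase a,
      ((nAB a).bipartiteAbove (fun a' b => b ∈ nAB a') a').card = (nAB a ∩ nAB a').card := by
    intro a' _
    congr 1
  have hR : ∀ b ∈ nAB a, ((univ.erase a).bipartiteBelow (fun a' b => b ∈ nAB a') b).card = d - 1 := by
    intro b hb
    have : (univ.erase a).bipartiteBelow (fun a' b => b ∈ nAB a') b = (nBA b).erase a := by
      ext a'
      simp only [bipartiteBelow, mem_filter, mem_erase, mem_univ, and_true, cAB]
    rw [this, card_erase_of_mem ((cAB a b).1 hb), rBA]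
  rw [sum_congr rfl hL, sum_congr rfl hR, sum_const, rAB, smul_eq_mul] at hdc
  exact hdc

omit [Fintype α] [Fintype β] [DecidableEq α] in
/-- Two `d`-sets meeting in at least `d` levels are equal. -/
theorem eq_of_le_inter_card (d : ℕ) (nAB : α → Finset β) (rAB : ∀ a, (nAB a).card = d) {a a' : α}
    (h : d ≤ (nAB a ∩ nAB a').card) : nAB a' = nAB a := by
  have h1 : nAB a ∩ nAB a' = nAB a := eq_of_subset_of_card_le inter_subset_left (by rw [rAB]; exact h)
  have h2 : nAB a ∩ nAB a' = nAB a' := eq_of_subset_of_card_le inter_subset_right (by rw [rAB]; exact h)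
  rw [← h2, h1]

omit [Fintype α] [DecidableEq α] in
/-- **Mates** (`d ≥ 2`). Every codegree `#(nAB a ∩ nAB a')` is `0` or at least `d - 1`: a common `B`-neighbour
forces (by `le_inter_card_succ` with `B` and `C` exchanged) at least `d - 1 ≥ 1` common `C`-neighbours, and a common
`C`-neighbour forces at least `d - 1` common `B`-neighbours. -/
theorem inter_card_eq_zero_or (d : ℕ) (hd : 2 ≤ d) (hβ : Fintype.card β = 2 * d + 1)
    (hγ : Fintype.card γ = 2 * d + 1)
    (nAB : α → Finset β) (nAC : α → Finset γ) (nBC : β → Finset γ) (nCB : γ → Finset β)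
    (cBC : ∀ b c, c ∈ nBC b ↔ b ∈ nCB c)
    (rAB : ∀ a, (nAB a).card = d) (rAC : ∀ a, (nAC a).card = d)
    (rBC : ∀ b, (nBC b).card = d) (rCB : ∀ c, (nCB c).card = d)
    (tABC : ∀ a b c, b ∈ nAB a → c ∈ nBC b → c ∉ nAC a) (a a' : α) :
    (nAB a ∩ nAB a').card = 0 ∨ d ≤ (nAB a ∩ nAB a').card + 1 := by
  by_cases h0 : (nAB a ∩ nAB a').card = 0
  · exact Or.inl h0
  right
  obtain ⟨b, hb⟩ := card_pos.1 (Nat.pos_of_ne_zero h0)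
  rw [mem_inter] at hb
  have hC : d ≤ (nAC a ∩ nAC a').card + 1 :=
    le_inter_card_succ d hγ nAC nAB nCB nBC (fun c b => (cBC b c).symm) rAC rBC
      (fun a c b hc hcb hb => tABC a b c hb ((cBC b c).2 hcb) hc) hb.1 hb.2
  obtain ⟨c, hc⟩ := card_pos.1 (by omega : 0 < (nAC a ∩ nAC a').card)
  rw [mem_inter] at hc
  exact le_inter_card_succ d hβ nAB nAC nBC nCB cBC rAB rCB tABC hc.1 hc.2

omit [Fintype α] [Fintype γ] [DecidableEq α] in
/-- A pair with no common `B`-neighbour has no common `C`-neighbour (`d ≥ 2`). -/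
theorem inter_card_eq_zero_of (d : ℕ) (hd : 2 ≤ d) (hβ : Fintype.card β = 2 * d + 1)
    (nAB : α → Finset β) (nAC : α → Finset γ) (nBC : β → Finset γ) (nCB : γ → Finset β)
    (cBC : ∀ b c, c ∈ nBC b ↔ b ∈ nCB c)
    (rAB : ∀ a, (nAB a).card = d) (rCB : ∀ c, (nCB c).card = d)
    (tABC : ∀ a b c, b ∈ nAB a → c ∈ nBC b → c ∉ nAC a) {a a' : α}
    (h0 : (nAB a ∩ nAB a').card = 0) : (nAC a ∩ nAC a').card = 0 := by
  by_contra h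
  obtain ⟨c, hc⟩ := card_pos.1 (Nat.pos_of_ne_zero h)
  rw [mem_inter] at hc
  have := le_inter_card_succ d hβ nAB nAC nBC nCB cBC rAB rCB tABC hc.1 hc.2
  omega

/-- **Dichotomy, twin-free case.** If the level `a` has no twin for `nAB` (`nAB a' ≠ nAB a` for `a' ≠ a`), then its
mate set `M` (the levels `a' ≠ a` with a common `B`-neighbour) has exactly `d` elements and every mate has codegree
exactly `d - 1` (stated additively). For: every mate's codegree lies in `[d-1, d]` and is `≠ d` (twins), and the
codegrees sum to `d (d-1)`. -/
theorem card_mates_of_twin_free (d : ℕ) (hd : 2 ≤ d) (hβ : Fintype.card β = 2 * d + 1)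
    (hγ : Fintype.card γ = 2 * d + 1)
    (nAB : α → Finset β) (nBA : β → Finset α) (nAC : α → Finset γ) (nBC : β → Finset γ) (nCB : γ → Finset β)
    (cAB : ∀ a b, b ∈ nAB a ↔ a ∈ nBA b) (cBC : ∀ b c, c ∈ nBC b ↔ b ∈ nCB c)
    (rAB : ∀ a, (nAB a).card = d) (rBA : ∀ b, (nBA b).card = d) (rAC : ∀ a, (nAC a).card = d)
    (rBC : ∀ b, (nBC b).card = d) (rCB : ∀ c, (nCB c).card = d)
    (tABC : ∀ a b c, b ∈ nAB a → c ∈ nBC b → c ∉ nAC a) (a : α)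
    (htf : ∀ a', a' ≠ a → nAB a' ≠ nAB a) :
    ((univ.erase a).filter (fun a' => (nAB a ∩ nAB a').card ≠ 0)).card = d ∧
      ∀ a' ∈ (univ.erase a).filter (fun a' => (nAB a ∩ nAB a').card ≠ 0),
        (nAB a ∩ nAB a').card + 1 = d := by
  set M := (univ.erase a).filter (fun a' => (nAB a ∩ nAB a').card ≠ 0) with hM
  have hterm : ∀ a' ∈ M, (nAB a ∩ nAB a').card + 1 = d := by
    intro a' ha'
    rw [hM, mem_filter, mem_erase] at ha'
    have hge := (inter_card_eq_zero_or d hd hβ hγ nAB nAC nBC nCB cBC rAB rAC rBC rCB tABC a a').resolve_left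
      ha'.2
    have hle : (nAB a ∩ nAB a').card ≤ d := (card_le_card inter_subset_left).trans (rAB a).le
    have hne : (nAB a ∩ nAB a').card ≠ d := fun h => htf a' ha'.1.1 (eq_of_le_inter_card d nAB rAB h.ge)
    omega
  refine ⟨?_, hterm⟩
  have hsum : ∑ a' ∈ M, (nAB a ∩ nAB a').card = d * (d - 1) := by
    rw [hM, sum_filter_ne_zero]
    exact sum_inter_card d nAB nBA cAB rAB rBA a
  have h2 : ∑ a' ∈ M, ((nAB a ∩ nAB a').card + 1) = ∑ _a' ∈ M, d := sum_congr rfl hterm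
  rw [sum_add_distrib, hsum, sum_const, sum_const, smul_eq_mul, smul_eq_mul, mul_one] at h2
  -- h2 : d * (d - 1) + M.card = M.card * d
  obtain ⟨e, rfl⟩ : ∃ e, d = e + 1 := ⟨d - 1, by omega⟩
  have he : 0 < e := by omega
  rw [Nat.add_sub_cancel] at h2
  have h3 : M.card * (e + 1) = M.card * e + M.card := by ring
  have h4 : M.card * e = (e + 1) * e := by omega
  exact Nat.eq_of_mul_eq_mul_right he h4

/-- **Dichotomy, twin case.** If the level `a` has a twin `a₂ ≠ a` (`nAB a₂ = nAB a`), then its mate set `M` has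
exactly `d - 1` elements (stated additively) and EVERY mate is a twin, in `B` and in `C`
(`nAB a' = nAB a`, `nAC a' = nAC a`). For: the codegrees of the mates lie in `[d-1, d]`, sum to `d (d-1)`, and one of
them is `d`; this forces `#M = d - 1` and all of them `= d`; the `C`-codegrees of the same `d - 1` mates (non-mates
contribute `0`) are `≤ d` and also sum to `d (d-1)`. -/
theorem twins_of_twin (d : ℕ) (hd : 2 ≤ d) (hβ : Fintype.card β = 2 * d + 1)
    (hγ : Fintype.card γ = 2 * d + 1)
    (nAB : α → Finset β) (nBA : β → Finset α) (nAC : α → Finset γ) (nCA : γ → Finset α)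
    (nBC : β → Finset γ) (nCB : γ → Finset β)
    (cAB : ∀ a b, b ∈ nAB a ↔ a ∈ nBA b) (cAC : ∀ a c, c ∈ nAC a ↔ a ∈ nCA c)
    (cBC : ∀ b c, c ∈ nBC b ↔ b ∈ nCB c)
    (rAB : ∀ a, (nAB a).card = d) (rBA : ∀ b, (nBA b).card = d) (rAC : ∀ a, (nAC a).card = d)
    (rCA : ∀ c, (nCA c).card = d) (rBC : ∀ b, (nBC b).card = d) (rCB : ∀ c, (nCB c).card = d)
    (tABC : ∀ a b c, b ∈ nAB a → c ∈ nBC b → c ∉ nAC a)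
    {a a₂ : α} (hne : a₂ ≠ a) (htw : nAB a₂ = nAB a) :
    ((univ.erase a).filter (fun a' => (nAB a ∩ nAB a').card ≠ 0)).card + 1 = d ∧
      ∀ a' ∈ (univ.erase a).filter (fun a' => (nAB a ∩ nAB a').card ≠ 0),
        nAB a' = nAB a ∧ nAC a' = nAC a := by
  set M := (univ.erase a).filter (fun a' => (nAB a ∩ nAB a').card ≠ 0) with hM
  have hmemM : ∀ a', a' ∈ M ↔ a' ≠ a ∧ (nAB a ∩ nAB a').card ≠ 0 := by
    intro a'
    rw [hM, mem_filter, mem_erase]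
    simp only [mem_univ, and_true]
  have ha₂ : a₂ ∈ M := (hmemM a₂).2 ⟨hne, by rw [htw, inter_self, rAB]; omega⟩
  have hge : ∀ a' ∈ M, d ≤ (nAB a ∩ nAB a').card + 1 := fun a' ha' =>
    (inter_card_eq_zero_or d hd hβ hγ nAB nAC nBC nCB cBC rAB rAC rBC rCB tABC a a').resolve_left
      ((hmemM a').1 ha').2
  have hle : ∀ a', (nAB a ∩ nAB a').card ≤ d := fun a' =>
    (card_le_card inter_subset_left).trans (rAB a).le
  have hsum : ∑ a' ∈ M, (nAB a ∩ nAB a').card = d * (d - 1) := by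
    rw [hM, sum_filter_ne_zero]
    exact sum_inter_card d nAB nBA cAB rAB rBA a
  -- upper bound: the sum is at most `#M · d`
  have hup : d * (d - 1) ≤ M.card * d := by
    rw [← hsum, ← smul_eq_mul, ← sum_const]
    exact sum_le_sum fun a' _ => hle a'
  -- lower bound: the term of `a₂` is `d`, the others are `≥ d - 1`
  have hlow : M.card * (d - 1) + 1 ≤ d * (d - 1) := by
    have h1 : ∑ _a' ∈ M.erase a₂, (d - 1) ≤ ∑ a' ∈ M.erase a₂, (nAB a ∩ nAB a').card :=
      sum_le_sum fun a' ha' => by have := hge a' (mem_of_mem_erase ha'); omega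
    rw [sum_const, smul_eq_mul, card_erase_of_mem ha₂] at h1
    have h2 := sum_erase_add M (fun a' => (nAB a ∩ nAB a').card) ha₂
    rw [htw, inter_self, rAB, hsum] at h2
    have hMpos : 1 ≤ M.card := card_pos.2 ⟨a₂, ha₂⟩
    obtain ⟨k, hk⟩ : ∃ k, M.card = k + 1 := ⟨M.card - 1, by omega⟩
    rw [hk, Nat.add_sub_cancel] at h1
    rw [hk, add_mul, one_mul]
    omega
  have hcard : M.card + 1 = d := by
    have h1 : d - 1 ≤ M.card := by
      have : d * (d - 1) ≤ d * M.card := by rw [mul_comm d M.card]; exact hup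
      exact Nat.le_of_mul_le_mul_left this (by omega)
    have h2 : M.card + 1 ≤ d := by
      by_contra h
      have hdm : d ≤ M.card := by omega
      have := Nat.mul_le_mul_right (d - 1) hdm
      omega
    omega
  refine ⟨hcard, ?_⟩
  have hMd : M.card = d - 1 := by omega
  -- all `B`-codegrees of mates equal `d`
  have hall : ∀ a' ∈ M, (nAB a ∩ nAB a').card = d := by
    have heq : ∑ a' ∈ M, (nAB a ∩ nAB a').card = ∑ _a' ∈ M, d := by
      rw [sum_const, smul_eq_mul, hsum, hMd, mul_comm]
    exact (sum_eq_sum_iff_of_le fun a' _ => hle a').1 heq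
  -- all `C`-codegrees of mates equal `d`
  have hCle : ∀ a', (nAC a ∩ nAC a').card ≤ d := fun a' =>
    (card_le_card inter_subset_left).trans (rAC a).le
  have hCsumM : ∑ a' ∈ M, (nAC a ∩ nAC a').card = d * (d - 1) := by
    rw [← sum_inter_card d nAC nCA cAC rAC rCA a]
    refine sum_subset (filter_subset _ _) fun a' ha' hnot => ?_
    have hB0 : (nAB a ∩ nAB a').card = 0 := by
      by_contra h
      exact hnot ((hmemM a').2 ⟨(mem_erase.1 ha').1, h⟩)
    exact inter_card_eq_zero_of d hd hβ nAB nAC nBC nCB cBC rAB rCB tABC hB0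
  have hCall : ∀ a' ∈ M, (nAC a ∩ nAC a').card = d := by
    have heq : ∑ a' ∈ M, (nAC a ∩ nAC a').card = ∑ _a' ∈ M, d := by
      rw [sum_const, smul_eq_mul, hCsumM, hMd, mul_comm]
    exact (sum_eq_sum_iff_of_le fun a' _ => hCle a').1 heq
  intro a' ha'
  exact ⟨eq_of_le_inter_card d nAB rAB (hall a' ha').ge, eq_of_le_inter_card d nAC rAC (hCall a' ha').ge⟩

/-- **The twin branch** (`d ≥ 2`). Twins `a₁ ≠ a₂` for `nAB` are impossible: with `T = {a₁} ∪ mates(a₁)` (`d`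
levels by `twins_of_twin`, `nAB = X := nAB a₁` and `nAC = Z := nAC a₁` on `T`), a `B`-level outside `X` and a
`C`-level outside `Z` both have their `d` `A`-neighbours among the `d + 1` levels of `Tᶜ`, hence share one, hence
are not adjacent; so every `B`-level outside `X` has `C`-neighbourhood exactly `Z`, and a level of `Z` gets
`≥ d + 1 > d` `B`-neighbours. -/
theorem false_of_twins (d : ℕ) (hd : 2 ≤ d) (hα : Fintype.card α = 2 * d + 1)
    (hβ : Fintype.card β = 2 * d + 1) (hγ : Fintype.card γ = 2 * d + 1)
    (nAB : α → Finset β) (nBA : β → Finset α) (nAC : α → Finset γ) (nCA : γ → Finset α)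
    (nBC : β → Finset γ) (nCB : γ → Finset β)
    (cAB : ∀ a b, b ∈ nAB a ↔ a ∈ nBA b) (cAC : ∀ a c, c ∈ nAC a ↔ a ∈ nCA c)
    (cBC : ∀ b c, c ∈ nBC b ↔ b ∈ nCB c)
    (rAB : ∀ a, (nAB a).card = d) (rBA : ∀ b, (nBA b).card = d) (rAC : ∀ a, (nAC a).card = d)
    (rCA : ∀ c, (nCA c).card = d) (rBC : ∀ b, (nBC b).card = d) (rCB : ∀ c, (nCB c).card = d)
    (tABC : ∀ a b c, b ∈ nAB a → c ∈ nBC b → c ∉ nAC a)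
    {a₁ a₂ : α} (hne : a₁ ≠ a₂) (htw : nAB a₁ = nAB a₂) : False := by
  obtain ⟨hcard, htwins⟩ := twins_of_twin d hd hβ hγ nAB nBA nAC nCA nBC nCB cAB cAC cBC rAB rBA rAC rCA
    rBC rCB tABC hne.symm htw.symm
  set M := (univ.erase a₁).filter (fun a' => (nAB a₁ ∩ nAB a').card ≠ 0) with hM
  have ha₁M : a₁ ∉ M := by
    rw [hM, mem_filter, mem_erase]
    exact fun h => h.1.1 rfl
  set T : Finset α := insert a₁ M with hT
  have hTcard : T.card = d := by rw [hT, card_insert_of_notMem ha₁M]; exact hcard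
  have hTc : (Tᶜ).card = d + 1 := by rw [card_compl, hTcard, hα]; omega
  -- on T the neighbourhood maps are constant
  have hTB : ∀ a ∈ T, nAB a = nAB a₁ := by
    intro a ha
    rw [hT, mem_insert] at ha
    rcases ha with rfl | ha
    · rfl
    · exact (htwins a ha).1
  have hTC : ∀ a ∈ T, nAC a = nAC a₁ := by
    intro a ha
    rw [hT, mem_insert] at ha
    rcases ha with rfl | ha
    · rfl
    · exact (htwins a ha).2
  -- levels outside X resp. Z have their A-neighbours in Tᶜ
  have hBout : ∀ b, b ∉ nAB a₁ → nBA b ⊆ Tᶜ := by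
    intro b hb a ha
    rw [mem_compl]
    intro haT
    exact hb (hTB a haT ▸ (cAB a b).2 ha)
  have hCout : ∀ c, c ∉ nAC a₁ → nCA c ⊆ Tᶜ := by
    intro c hc a ha
    rw [mem_compl]
    intro haT
    exact hc (hTC a haT ▸ (cAC a c).2 ha)
  -- such b and c are never adjacent (two d-subsets of the (d+1)-set Tᶜ meet; a common level is a triangle)
  have hnadj : ∀ b, b ∉ nAB a₁ → ∀ c, c ∉ nAC a₁ → c ∉ nBC b := by
    intro b hb c hc hbc
    have hdisj : Disjoint (nBA b) (nCA c) := by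
      rw [Finset.disjoint_left]
      intro a hab hac
      exact tABC a b c ((cAB a b).2 hab) hbc ((cAC a c).2 hac)
    have := card_le_card (union_subset (hBout b hb) (hCout c hc))
    rw [card_union_of_disjoint hdisj, rBA, rCA, hTc] at this
    omega
  -- hence every B-level outside X has C-neighbourhood exactly Z = nAC a₁
  have hBZ : ∀ b, b ∉ nAB a₁ → nBC b = nAC a₁ := by
    intro b hb
    apply eq_of_subset_of_card_le
    · intro c hc
      by_contra hcZ
      exact hnadj b hb c hcZ hc
    · rw [rBC, rAC]
  -- pick a level c of Z: all d + 1 B-levels outside X are B-neighbours of c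
  obtain ⟨c, hc⟩ : (nAC a₁).Nonempty := card_pos.1 (by rw [rAC]; omega)
  have hsub : (nAB a₁)ᶜ ⊆ nCB c := by
    intro b hb
    rw [mem_compl] at hb
    exact (cBC b c).1 (hBZ b hb ▸ hc)
  have := card_le_card hsub
  rw [card_compl, rAB, hβ, rCB] at this
  omega

end Summit.Ventures.HSemireg.NoFlatTwoDPlusOneDichotomy
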